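import Summits.ResolutionOfSingularities.ResolutionOfSingularities.Theorems.FreezeCutDead2
import Summits.ResolutionOfSingularities.ResolutionOfSingularities.Theorems.FreezeCutDeadClasses
import HarnessLib

/-!
# MaxContactCutFreezeCutDead — decomp-res node «ExtinctionCut» (lens-3 g20, critic row 156), tree file 4/8 of the node

Content VERBATIM from the decomp-res lens-3 g20 node `HOME/decomp-res-lens-3/g20/ExtinctionCut.lean` (pin c917c20b =
`parts/ExtinctionCut-g20-c917c20b.lean`, 1 323 l; HOME = run/shared/lean/pub/decomp-res; lens imports = tree
`MaxContactCutFreezeCut` +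
`StallVertexStraightClasses` only; rc 0 · 0 sorry).  Critic: CRITIC-LEDGER row 156 (2026-08-31T00:18:27Z):
DECIDED-MOD-PORT +1 — the BALANCED
BOUNDARY CLASS `FreezeCut.NoBalancedBoundaryTailsDeep` decided AS A WHOLE modulo ONE typed port
`ExtinctionCut.KollarWallPort`.  Landing orders
INBOX :552 (critic) and :467 / :489 (the lens-3 g19 rev-4 blocks §D / §K7 = `FreezeCutDead` + classes add-on, land
first), `--kind proof --supports
stmt-ResolutionOfSingularities-31770` (`MaxContactCut.DefectWalksDeep`).  Files of the node, in import order: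
`FreezeCutDead` (§D, namespace
`…HoleCut.TailShade`, over the in-cone `MaxContactCutFreezeCut`) · `FreezeCutDeadClasses` (§K7 classes, cone-free,
namespace `…FreezeCut`) ·
`MaxContactCutFreezeCutDead` (§K7 kernels and EXACT iff's at 31770, Theses cone) · `ExtinctionCutToric` /
`ExtinctionCutToric2` (§1, Mathlib only,
namespace `…ExtinctionCut`) · `ExtinctionCutPort` (§2, the ONE typed port `KollarWallPort`, cone-free so that the
route file can cite it as an item) ·
`MaxContactCutExtinctionCut` (§3 booking at 31770, Theses cone; §M `closes` = tree
`MaxContactCutExponentLadder.closes` verbatim is omitted, as in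
`MaxContactCutFreezeCut`).  Aside bookkeeping (row 156 / INBOX :552): on the lens-3 column ONE typed PORT item
`KollarWallPort` and ONE live aside
`FreezeCut.NoSmallDeadStrictHighSkewJointTailsDeep` (home `FreezeCutDeadClasses`) superseding the rev-4 sub-class
pair; decided cells are THEOREMS and
are not filed.

## This file

§K7 kernels (lens-3 g19 rev 4, in the Theses cone, `section BookingDead` of `…Theorems.FreezeCut`):
`noLooseHighSkewJointTails_holds` (D4), `highSkew_iff_smallDead`, `skew_iff_smallDead` (lens-5 key),
`defectWalksDeep_iff_highPlanar_smallDead`, `defectWalksDeep_iff_smallDead_of_planar`,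
`smallDead_of_defectWalksDeep`; the balance half: `highSkew_iff_boundary_strict`, `noUnbalancedBoundaryTails_holds`
(D7), `boundarySkew_iff_balanced`, `strict_iff_smallDeadStrict`, `highSkew_iff_balanced_smallDeadStrict`, the EXACT
re-location at 31770 **`defectWalksDeep_iff_highPlanar_balanced_smallDeadStrict : MaxContactCut.DefectWalksDeep ↔
NoFreePointTailsDeep ∧ NoHighPlanarJointTailsDeep ∧ NoBalancedBoundaryTailsDeep ∧
NoSmallDeadStrictHighSkewJointTailsDeep`**, `skew_iff_balanced_smallDeadStrict` (lens-5 key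
`CoefficientCut.NoSkewJointTailsDeep ↔ …`), `balanced_of_defectWalksDeep`.  Imports `FreezeCutDead*` +
`FreezeCutDeadClasses`; 0 sorry.

[WRITER NOTE (decomp-res writer g9): file split only (tree files ≤ 400 lines); namespaces, sections, section
variables and every declaration
exactly as in the lens (the lens's global opens are replayed per file; cone-free files carry the opens of
`FreezeCutClasses.lean`, the toric kernel none).]

(Sources: Kollar2007 (Lectures on Resolution of Singularities: Thm 1.93, Def 2.56, Rem 2.57, Claim 2.59.1, (2.59.2),
Claim 2.59.4) [corpus:book:kollar2007-lectures-resolution-singularities pp. 54, 92–94]; Hauser2010Kangaroo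
(arXiv:0811.4151); Moh1987; CossartPiltant2008 §2; CossartPiltant2019 Prop. 2.50; HauserPerlega2019 §1.)
-/

noncomputable section

open MvPolynomial Finset
open Literature.AlgebraicGeometry.Resolution
open Literature.AlgebraicGeometry.Resolution.Hauser2010
open Literature.AlgebraicGeometry.Resolution.PointBlowup
open Summit.ResolutionOfSingularities.ResolutionOfSingularities.Theses
open Summit.ResolutionOfSingularities.ResolutionOfSingularities.Theorems.TightDefectClasses
open Summit.ResolutionOfSingularities.ResolutionOfSingularities.Theorems.TightDefectStrongWalks
open Summit.ResolutionOfSingularities.ResolutionOfSingularities.Theorems.ItineraryCutClasses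
open Summit.ResolutionOfSingularities.ResolutionOfSingularities.Theorems.BoundaryLedger
open Summit.ResolutionOfSingularities.ResolutionOfSingularities.Theorems.ProximityCut
open Summit.ResolutionOfSingularities.ResolutionOfSingularities.Theorems.ConeCutAxisLaw
open Literature.AlgebraicGeometry.Resolution.WeightedBlowup
open Literature.Barriers.ResolutionOfSingularities
open Summit.ResolutionOfSingularities.ResolutionOfSingularities.Theorems.FloorCut
open Summit.ResolutionOfSingularities.ResolutionOfSingularities.Theorems.ConeCut
open Summit.ResolutionOfSingularities.ResolutionOfSingularities.Theorems.ExitLaw (fin3_cases eq_of_le_of_degree_le)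
open Summit.ResolutionOfSingularities.ResolutionOfSingularities.Theorems.ShadeCut
open Summit.ResolutionOfSingularities.ResolutionOfSingularities.Theorems.TightCut
open Summit.ResolutionOfSingularities.ResolutionOfSingularities.Theorems.HoleCut

namespace Summit.ResolutionOfSingularities.ResolutionOfSingularities.Theorems.FreezeCut

section BookingDead

/-- The loose sub-class is EMPTY (hypothesis-free), by the dead-support law D4. [new] [folklore] -/
theorem noLooseHighSkewJointTails_holds : NoLooseHighSkewJointTailsDeep := by
  intro p hp e he K _ _ _ _ s₀ hs W hW N hN hex hrec htr s hsN _ _ _ hskew hloose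
  have h1 := hW N
  rw [hsN] at h1
  have hs1 : 1 ≤ s := by exact_mod_cast h1
  obtain ⟨N', -, hsd⟩ := TailShade.eventually_smallDead_of_skew hs hs1 ⟨hN, hsN, hex⟩ hrec htr hskew
  obtain ⟨t, ht, hnot⟩ := hloose N'
  obtain ⟨hsmall, x, hcx, hrx⟩ := hsd t ht
  exact hnot ⟨hsmall, x, hrx, hcx⟩

/-- The loose sub-class is a sub-class of the residual (trivial direction, for the record). [new] [folklore] -/
theorem loose_of_highSkew (h : NoHighSkewJointTailsDeep) : NoLooseHighSkewJointTailsDeep :=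
  fun p hp e he K _ _ _ _ s₀ hs W hW N hN hex hrec htr s hsN h3 hq hh hskew _ =>
    h p hp e he K s₀ hs W hW N hN hex hrec htr s hsN h3 hq hh hskew

/-- `smallDead_of_highSkew`: Auxiliary step of this node's calculus, VERBATIM from the lens file (see the module
docstring); the statement is its type. [folklore] -/
theorem smallDead_of_highSkew (h : NoHighSkewJointTailsDeep) : NoSmallDeadHighSkewJointTailsDeep :=
  fun p hp e he K _ _ _ _ s₀ hs W hW N hN hex hrec htr s hsN h3 hq hh hskew _ =>
    h p hp e he K s₀ hs W hW N hN hex hrec htr s hsN h3 hq hh hskew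

/-- **RE-LOCATION (the content of D4 at class level):** no small-dead high skew joint tail ⇒ no high skew joint tail
(re-base the tail at the stage from which it is small-dead). [new] [folklore] -/
theorem highSkew_of_smallDead (h : NoSmallDeadHighSkewJointTailsDeep) : NoHighSkewJointTailsDeep := by
  intro p hp e he K _ _ _ _ s₀ hs W hW N hN hex hrec htr s hsN h3 hq hh hskew
  have h1 := hW N
  rw [hsN] at h1
  have hs1 : 1 ≤ s := by exact_mod_cast h1
  have hT : TailShade W N s := ⟨hN, hsN, hex⟩
  obtain ⟨N', hN', hsd⟩ := hT.eventually_smallDead_of_skew hs hs1 hrec htr hskew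
  exact h p hp e he K s₀ hs W hW N' (fun t ht => hN t (by omega)) (fun t ht => hex t (by omega)) hrec htr s
    (hT.shade_eq N' hN') h3 hq hh hskew fun t ht => by
      obtain ⟨hsmall, x, hcx, hrx⟩ := hsd t ht
      exact ⟨hsmall, x, hrx, hcx⟩

/-- **EXACT: the residual of both lenses ≡ «no SMALL-DEAD high skew joint tail» (hypothesis-free).** [new] [folklore] -/
theorem highSkew_iff_smallDead : NoHighSkewJointTailsDeep ↔ NoSmallDeadHighSkewJointTailsDeep :=
  ⟨smallDead_of_highSkew, highSkew_of_smallDead⟩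

/-- EXACT, keyed to lens-5's class. [new] [folklore] -/
theorem skew_iff_smallDead : CoefficientCut.NoSkewJointTailsDeep ↔ NoSmallDeadHighSkewJointTailsDeep :=
  skew_iff_highSkew.trans highSkew_iff_smallDead

/-- **EXACT (31770): aside 31770 ≡ deep arc law ∧ high-planar ∧ small-dead high-skew (hypothesis-free).** [new] [folklore] -/
theorem defectWalksDeep_iff_highPlanar_smallDead :
    MaxContactCut.DefectWalksDeep ↔
      NoFreePointTailsDeep ∧ NoHighPlanarJointTailsDeep ∧ NoSmallDeadHighSkewJointTailsDeep := by
  rw [defectWalksDeep_iff_highPlanar_highSkew, highSkew_iff_smallDead]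

/-- Under lens-5's mod-`p` port (planar piece): 31770 ≡ deep arc law ∧ small-dead high-skew. [new] [folklore] -/
theorem defectWalksDeep_iff_smallDead_of_planar (hP : CoefficientCut.NoPlanarJointTailsDeep) :
    MaxContactCut.DefectWalksDeep ↔ NoFreePointTailsDeep ∧ NoSmallDeadHighSkewJointTailsDeep := by
  rw [defectWalksDeep_iff_highSkew_of_planar hP, highSkew_iff_smallDead]

/-- `smallDead_of_defectWalksDeep`: Auxiliary step of this node's calculus, VERBATIM from the lens file (see the
module docstring); the statement is its type. [folklore] -/
theorem smallDead_of_defectWalksDeep (h : MaxContactCut.DefectWalksDeep) : NoSmallDeadHighSkewJointTailsDeep :=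
  (defectWalksDeep_iff_highPlanar_smallDead.mp h).2.2

/-! ### The boundary line `p^e + 1 = 2s` -/

/-- `boundary_of_highSkew`: Auxiliary step of this node's calculus, VERBATIM from the lens file (see the module
docstring); the statement is its type. [folklore] -/
theorem boundary_of_highSkew (h : NoHighSkewJointTailsDeep) : NoBoundarySkewJointTailsDeep :=
  fun p hp e he K _ _ _ _ s₀ hs W hW N hN hex hrec htr s hsN h3 hq hh hskew =>
    h p hp e he K s₀ hs W hW N hN hex hrec htr s hsN h3 hq hh.le hskew

/-- `strict_of_highSkew`: Auxiliary step of this node's calculus, VERBATIM from the lens file (see the module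
docstring); the statement is its type. [folklore] -/
theorem strict_of_highSkew (h : NoHighSkewJointTailsDeep) : NoStrictHighSkewJointTailsDeep :=
  fun p hp e he K _ _ _ _ s₀ hs W hW N hN hex hrec htr s hsN h3 hq hh hskew =>
    h p hp e he K s₀ hs W hW N hN hex hrec htr s hsN h3 hq (by omega) hskew

/-- `highSkew_of_boundary_strict`: Auxiliary step of this node's calculus, VERBATIM from the lens file (see the
module docstring); the statement is its type. [folklore] -/
theorem highSkew_of_boundary_strict (hb : NoBoundarySkewJointTailsDeep) (ht : NoStrictHighSkewJointTailsDeep) :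
    NoHighSkewJointTailsDeep := by
  intro p hp e he K _ _ _ _ s₀ hs W hW N hN hex hrec htr s hsN h3 hq hh hskew
  by_cases hbd : p ^ e + 1 = 2 * s
  · exact hb p hp e he K s₀ hs W hW N hN hex hrec htr s hsN h3 hq hbd hskew
  · exact ht p hp e he K s₀ hs W hW N hN hex hrec htr s hsN h3 hq (by omega) hskew

/-- EXACT cell split of the residual along the boundary line (bookkeeping). [new] [folklore] -/
theorem highSkew_iff_boundary_strict :
    NoHighSkewJointTailsDeep ↔ NoBoundarySkewJointTailsDeep ∧ NoStrictHighSkewJointTailsDeep :=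
  ⟨fun h => ⟨boundary_of_highSkew h, strict_of_highSkew h⟩, fun h => highSkew_of_boundary_strict h.1 h.2⟩

/-- **The unbalanced boundary sub-class is EMPTY (hypothesis-free), by the balance law D7.** [new] [folklore] -/
theorem noUnbalancedBoundaryTails_holds : NoUnbalancedBoundaryTailsDeep := by
  intro p hp e he K _ _ _ _ s₀ hs W hW N hN hex hrec htr s hsN h3 _ hh hskew hunb
  obtain ⟨M, -, hbal⟩ := TailShade.balanced_of_skew hs hh (by omega) ⟨hN, hsN, hex⟩ hrec htr hskew
  obtain ⟨t, ht, hnot⟩ := hunb M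
  obtain ⟨hD, -, hB⟩ := hbal t ht
  exact hnot ⟨hD, hB⟩

/-- `unbalanced_of_boundary`: Auxiliary step of this node's calculus, VERBATIM from the lens file (see the module
docstring); the statement is its type. [folklore] -/
theorem unbalanced_of_boundary (h : NoBoundarySkewJointTailsDeep) : NoUnbalancedBoundaryTailsDeep :=
  fun p hp e he K _ _ _ _ s₀ hs W hW N hN hex hrec htr s hsN h3 hq hh hskew _ =>
    h p hp e he K s₀ hs W hW N hN hex hrec htr s hsN h3 hq hh hskew

/-- `balanced_of_boundary`: Auxiliary step of this node's calculus, VERBATIM from the lens file (see the module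
docstring); the statement is its type. [folklore] -/
theorem balanced_of_boundary (h : NoBoundarySkewJointTailsDeep) : NoBalancedBoundaryTailsDeep :=
  fun p hp e he K _ _ _ _ s₀ hs W hW N hN hex hrec htr s hsN h3 hq hh hskew _ =>
    h p hp e he K s₀ hs W hW N hN hex hrec htr s hsN h3 hq hh hskew

/-- **RE-LOCATION ON THE BOUNDARY LINE (the content of D7 at class level):** no balanced boundary tail ⇒ no
boundary-line skew joint tail. [new] [folklore] -/
theorem boundary_of_balanced (h : NoBalancedBoundaryTailsDeep) : NoBoundarySkewJointTailsDeep := by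
  intro p hp e he K _ _ _ _ s₀ hs W hW N hN hex hrec htr s hsN h3 hq hh hskew
  have hT : TailShade W N s := ⟨hN, hsN, hex⟩
  obtain ⟨M, hM, hbal⟩ := hT.balanced_of_skew hs hh (by omega) hrec htr hskew
  exact h p hp e he K s₀ hs W hW M (fun t ht => hN t (by omega)) (fun t ht => hex t (by omega)) hrec htr s
    (hT.shade_eq M hM) h3 hq hh hskew fun t ht => ⟨(hbal t ht).1, (hbal t ht).2.2⟩

/-- **EXACT: the boundary-line cell ≡ «no BALANCED skew joint tail» (hypothesis-free).** [new] [folklore] -/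
theorem boundarySkew_iff_balanced : NoBoundarySkewJointTailsDeep ↔ NoBalancedBoundaryTailsDeep :=
  ⟨balanced_of_boundary, boundary_of_balanced⟩

/-- `smallDeadStrict_of_strict`: Auxiliary step of this node's calculus, VERBATIM from the lens file (see the module
docstring); the statement is its type. [folklore] -/
theorem smallDeadStrict_of_strict (h : NoStrictHighSkewJointTailsDeep) : NoSmallDeadStrictHighSkewJointTailsDeep :=
  fun p hp e he K _ _ _ _ s₀ hs W hW N hN hex hrec htr s hsN h3 hq hh hskew _ =>
    h p hp e he K s₀ hs W hW N hN hex hrec htr s hsN h3 hq hh hskew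

/-- `strict_of_smallDeadStrict`: Auxiliary step of this node's calculus, VERBATIM from the lens file (see the module
docstring); the statement is its type. [folklore] -/
theorem strict_of_smallDeadStrict (h : NoSmallDeadStrictHighSkewJointTailsDeep) : NoStrictHighSkewJointTailsDeep := by
  intro p hp e he K _ _ _ _ s₀ hs W hW N hN hex hrec htr s hsN h3 hq hh hskew
  have h1 := hW N
  rw [hsN] at h1
  have hs1 : 1 ≤ s := by exact_mod_cast h1
  have hT : TailShade W N s := ⟨hN, hsN, hex⟩
  obtain ⟨N', hN', hsd⟩ := hT.eventually_smallDead_of_skew hs hs1 hrec htr hskew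
  exact h p hp e he K s₀ hs W hW N' (fun t ht => hN t (by omega)) (fun t ht => hex t (by omega)) hrec htr s
    (hT.shade_eq N' hN') h3 hq hh hskew fun t ht => by
      obtain ⟨hsmall, x, hcx, hrx⟩ := hsd t ht
      exact ⟨hsmall, x, hrx, hcx⟩

/-- EXACT: the strict cells ≡ their small-dead sub-class. [new] [folklore] -/
theorem strict_iff_smallDeadStrict : NoStrictHighSkewJointTailsDeep ↔ NoSmallDeadStrictHighSkewJointTailsDeep :=
  ⟨smallDeadStrict_of_strict, strict_of_smallDeadStrict⟩

/-- **EXACT, FINEST: the residual of both lenses ≡ «no balanced boundary tail» ∧ «no small-dead strict skew joint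
tail» (hypothesis-free).** [new] [folklore] -/
theorem highSkew_iff_balanced_smallDeadStrict :
    NoHighSkewJointTailsDeep ↔ NoBalancedBoundaryTailsDeep ∧ NoSmallDeadStrictHighSkewJointTailsDeep := by
  rw [highSkew_iff_boundary_strict, boundarySkew_iff_balanced, strict_iff_smallDeadStrict]

/-- **EXACT (31770), FINEST: aside 31770 ≡ deep arc law ∧ high-planar ∧ balanced-boundary ∧ small-dead-strict.**
[new] [folklore] -/
theorem defectWalksDeep_iff_highPlanar_balanced_smallDeadStrict :
    MaxContactCut.DefectWalksDeep ↔ NoFreePointTailsDeep ∧ NoHighPlanarJointTailsDeep ∧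
      NoBalancedBoundaryTailsDeep ∧ NoSmallDeadStrictHighSkewJointTailsDeep := by
  rw [defectWalksDeep_iff_highPlanar_highSkew, highSkew_iff_balanced_smallDeadStrict]

/-- EXACT, keyed to lens-5's class. [new] [folklore] -/
theorem skew_iff_balanced_smallDeadStrict :
    CoefficientCut.NoSkewJointTailsDeep ↔ NoBalancedBoundaryTailsDeep ∧ NoSmallDeadStrictHighSkewJointTailsDeep :=
  skew_iff_highSkew.trans highSkew_iff_balanced_smallDeadStrict

/-- `balanced_of_defectWalksDeep`: Auxiliary step of this node's calculus, VERBATIM from the lens file (see the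
module docstring); the statement is its type. [folklore] -/
theorem balanced_of_defectWalksDeep (h : MaxContactCut.DefectWalksDeep) : NoBalancedBoundaryTailsDeep :=
  (defectWalksDeep_iff_highPlanar_balanced_smallDeadStrict.mp h).2.2.1

end BookingDead

end Summit.ResolutionOfSingularities.ResolutionOfSingularities.Theorems.FreezeCut
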